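import Summits.QuantumFields.BalabanUV.Beta.EriceFlowEnclosurePolyLogInversion

/-!
# Beta / EriceFlowEnclosurePolyLogInversionCanonical — THE INVERSE LETTERS ARE CANONICAL (pure real analysis, SERVICE): two pairs
# (φ₁, ψ₁), (φ₂, ψ₂) in which φ₁ − id and φ₂ − id carry the SAME letters P at order N and ψ_i → ∞ is an approximate right inverse
# of φ_i have the SAME inverse letters up to N — the letters Q of P2 #36i `polyLog_inverse` depend on P_0, …, P_N ALONE, not on the
# realization.  Device: the letter sum `S(y) = Σ_{k ≤ N} P_k(log y)∕y^k` is differentiable with `|S′(y)| ≤ c(1 + log y)^D∕y → 0`, so it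
# is ½-Lipschitz near ∞ (mean value theorem); two approximate solutions y₁, y₂ of `y + S(y) ≈ s` then satisfy `|y₁ − y₂| ≤ 2·(defects +
# errors) = O((1 + log s)^D∕s^{N+1})`, and an O((1 + log s)^D∕s^{N+1})-perturbation does not change letters up to N (P2 #36g
# `polyLog_letters_unique`) (β-flow team, prover 2 = lower ∕ positivity side, unit `b2b-balaban-beta-bflow-p2`, gen 22; module P2 #36k;
# over P2 #36i `…PolyLogInversion` (whose docstring announced this as true-but-unproved), P2 #36g-A `eval_abs_le` ∕ `abs_le_of_polyLog`)

HONEST FRAMING (page 1 of everything the β sub-cell writes): discharging `BetaPertH` makes Bałaban's UV stability UNCONDITIONAL — a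
real constructive-QFT result; it is NOT the continuum limit and NOT the Clay problem.  HONEST DEPENDENCY (cell reorg 2026-08-19,
verbatim): «continuum YM on T⁴ ⇐ BetaPertH ∧ nine spine estimates (0/9 proved); BetaPertH ⇐ (D1) ∧ (D4) ∧ CAP+tail; G-an2-4 gates
asym, D1 and NE2/3/4.»  THIS MODULE DISCHARGES NOTHING: [folklore] calculus (derivative of P(log y)∕y^k, the mean value inequality) on
abstract letters; no Erice sentence consumed; nothing of (1.22).

WHAT THIS FILE PROVES (0 sorry, 0 def, all [folklore]): §1 `letterTerm_hasDerivAt` (d∕dy [P(log y)∕y^k] = (P′(log y) − k·P(log y))∕y^{k+1}),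
`letterSum_deriv_bound` (|S′(y)| ≤ c(1 + log y)^D∕y on [1, ∞)), `letterSum_lipschitz_half` (∃ Y, ∀ y₁ y₂ ≥ Y, |S y₁ − S y₂| ≤ ½|y₁ − y₂|);
§2 **`approxInverse_close`** (two approximate right inverses of two maps with the same letters are O((1 + log s)^D∕s^{N+1})-close);
§3 HEADLINE **`polyLog_inverse_canonical`** (their inverse letters agree up to N), **`polyLog_inverse_letters_eq`** (packaged with P2 #36i:
the Q's produced for (φ₁, ψ₁) and (φ₂, ψ₂) coincide up to N); §4 **`inverseCoupling_letters_canonical`** (the shape P2 #36j uses: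
two Λ-coordinates `Λ₁(1∕·)`, `Λ₂(1∕·)` with the SAME expansion have inverse couplings `1∕σ₁`, `1∕σ₂` with the SAME letters up to N —
the running-coupling letters are universal functions of the Λ-letters (κ, C_Λ, c_0, …), bflow-p2 g22 X68′ INFO-1 answered).
NOT CLAIMED: the letters in closed form; anything about β, Λ, σ; (1.22); `BetaPertH`; continuum; Clay.
-/

namespace Summit.QuantumFields.BalabanUV.Beta.EriceFlowEnclosurePolyLogInversionCanonical

open Set Filter Topology
open Summit.QuantumFields.BalabanUV.Beta.EriceFlowEnclosurePolyLogLetters (eval_abs_le abs_le_of_polyLog polyLog_add polyLog_of_error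
  polyLog_congr polyLog_abs_const)
open Summit.QuantumFields.BalabanUV.Beta.EriceFlowEnclosureInverseLawAllOrders (tendsto_one_add_log_pow_div polyLog_letters_unique)
open Summit.QuantumFields.BalabanUV.Beta.EriceFlowEnclosurePolyLogInversion (inverse_apriori polyLog_inverse defect_of_rightInverse)

noncomputable section

/-! ## §1 The letter sum is ½-Lipschitz near ∞ -/

/-- `d∕dy [P(log y)∕y^k] = (P′(log y) − k·P(log y))∕y^{k+1}` for y > 0. [folklore] -/
theorem letterTerm_hasDerivAt (P : Polynomial ℝ) (k : ℕ) {y : ℝ} (hy : 0 < y) :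
    HasDerivAt (fun y : ℝ => P.eval (Real.log y) / y ^ k)
      (((Polynomial.derivative P).eval (Real.log y) - k * P.eval (Real.log y)) / y ^ (k + 1)) y := by
  have h1 : HasDerivAt (fun y : ℝ => P.eval (Real.log y)) ((Polynomial.derivative P).eval (Real.log y) * y⁻¹) y :=
    (P.hasDerivAt (Real.log y)).comp y (Real.hasDerivAt_log hy.ne')
  have h2 : HasDerivAt (fun y : ℝ => y ^ k) ((k : ℝ) * y ^ (k - 1)) y := hasDerivAt_pow k y
  have h := h1.fun_div h2 (pow_ne_zero k hy.ne')
  have e : ((Polynomial.derivative P).eval (Real.log y) * y⁻¹ * y ^ k - P.eval (Real.log y) * ((k : ℝ) * y ^ (k - 1)))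
        / (y ^ k) ^ 2
      = ((Polynomial.derivative P).eval (Real.log y) - k * P.eval (Real.log y)) / y ^ (k + 1) := by
    rcases Nat.eq_zero_or_pos k with hk | hk
    · subst hk
      simp [div_eq_mul_inv]
    · obtain ⟨j, rfl⟩ : ∃ j, k = j + 1 := ⟨k - 1, by omega⟩
      rw [Nat.add_sub_cancel]
      field_simp
      ring
  rw [← e]
  exact h

/-- **The derivative of the letter sum is small**: with `S(y) = Σ_{k ≤ N} P_k(log y)∕y^k` and `S′` its termwise derivative,
`|S′(y)| ≤ c·(1 + log y)^D∕y` for y ≥ 1 (P2 #36g-A `eval_abs_le` on P_k and P_k′, term by term). [folklore] -/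
theorem letterSum_deriv_bound (P : ℕ → Polynomial ℝ) :
    ∀ n : ℕ, ∃ c : ℝ, ∃ D : ℕ, 0 ≤ c ∧ ∀ y : ℝ, 1 ≤ y →
      |∑ k ∈ Finset.range n, ((Polynomial.derivative (P k)).eval (Real.log y) - k * (P k).eval (Real.log y)) / y ^ (k + 1)|
        ≤ c * (1 + Real.log y) ^ D / y := by
  intro n
  induction n with
  | zero => exact ⟨0, 0, le_rfl, fun y hy => by simp⟩
  | succ n ih =>
    obtain ⟨c, D, hc, hb⟩ := ih
    obtain ⟨c₁, hc₁, h₁⟩ := eval_abs_le (Polynomial.derivative (P n))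
    obtain ⟨c₂, hc₂, h₂⟩ := eval_abs_le (P n)
    refine ⟨c + (c₁ + n * c₂), max D (max (Polynomial.derivative (P n)).natDegree (P n).natDegree), by positivity,
      fun y hy => ?_⟩
    have hy0 : 0 < y := by linarith
    have hL : 0 ≤ Real.log y := Real.log_nonneg hy
    have h1L : 1 ≤ 1 + Real.log y := by linarith
    set M := max D (max (Polynomial.derivative (P n)).natDegree (P n).natDegree) with hM
    rw [Finset.sum_range_succ]
    refine (abs_add_le _ _).trans ?_
    have hA : |∑ k ∈ Finset.range n, ((Polynomial.derivative (P k)).eval (Real.log y) - k * (P k).eval (Real.log y)) / y ^ (k + 1)|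
        ≤ c * (1 + Real.log y) ^ M / y :=
      (hb y hy).trans (div_le_div_of_nonneg_right
        (mul_le_mul_of_nonneg_left (pow_le_pow_right₀ h1L (le_max_left _ _)) hc) hy0.le)
    have hB : |((Polynomial.derivative (P n)).eval (Real.log y) - n * (P n).eval (Real.log y)) / y ^ (n + 1)|
        ≤ (c₁ + n * c₂) * (1 + Real.log y) ^ M / y := by
      rw [abs_div, abs_of_pos (pow_pos hy0 _)]
      have hnum : |(Polynomial.derivative (P n)).eval (Real.log y) - n * (P n).eval (Real.log y)|
          ≤ (c₁ + n * c₂) * (1 + Real.log y) ^ M := by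
        refine (abs_sub _ _).trans ?_
        rw [abs_mul, Nat.abs_cast, add_mul]
        refine add_le_add ((h₁ _ hL).trans (mul_le_mul_of_nonneg_left (pow_le_pow_right₀ h1L ?_) hc₁)) ?_
        · exact (le_max_left _ _).trans (le_max_right _ _)
        · rw [mul_assoc]
          exact mul_le_mul_of_nonneg_left ((h₂ _ hL).trans
            (mul_le_mul_of_nonneg_left (pow_le_pow_right₀ h1L ((le_max_right _ _).trans (le_max_right _ _))) hc₂))
            (Nat.cast_nonneg n)
      have hden : y ≤ y ^ (n + 1) := le_self_pow₀ hy (by omega)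
      calc |(Polynomial.derivative (P n)).eval (Real.log y) - n * (P n).eval (Real.log y)| / y ^ (n + 1)
          ≤ (c₁ + n * c₂) * (1 + Real.log y) ^ M / y ^ (n + 1) := div_le_div_of_nonneg_right hnum (by positivity)
        _ ≤ (c₁ + n * c₂) * (1 + Real.log y) ^ M / y := div_le_div_of_nonneg_left (by positivity) hy0 hden
    calc _ ≤ c * (1 + Real.log y) ^ M / y + (c₁ + n * c₂) * (1 + Real.log y) ^ M / y := add_le_add hA hB
      _ = (c + (c₁ + n * c₂)) * (1 + Real.log y) ^ M / y := by ring

/-- **The letter sum is ½-Lipschitz near ∞** (the mean value inequality on `[Y, ∞)`, where `c(1 + log y)^D∕y ≤ ½`). [folklore] -/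
theorem letterSum_lipschitz_half (P : ℕ → Polynomial ℝ) (N : ℕ) :
    ∃ Y : ℝ, 1 ≤ Y ∧ ∀ y₁ y₂ : ℝ, Y ≤ y₁ → Y ≤ y₂ →
      |∑ k ∈ Finset.range (N + 1), (P k).eval (Real.log y₁) / y₁ ^ k - ∑ k ∈ Finset.range (N + 1), (P k).eval (Real.log y₂) / y₂ ^ k|
        ≤ 1 / 2 * |y₁ - y₂| := by
  obtain ⟨c, D, hc, hb⟩ := letterSum_deriv_bound P (N + 1)
  have hlim : Tendsto (fun y : ℝ => c * ((1 + Real.log y) ^ D / y)) atTop (𝓝 (c * 0)) :=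
    (tendsto_one_add_log_pow_div D).const_mul c
  rw [mul_zero] at hlim
  obtain ⟨Y, hY⟩ := Filter.eventually_atTop.1
    ((hlim.eventually (gt_mem_nhds (by norm_num : (0 : ℝ) < 1 / 2))).and (eventually_ge_atTop (1 : ℝ)))
  refine ⟨max Y 1, le_max_right _ _, fun y₁ y₂ hy₁ hy₂ => ?_⟩
  have hderiv : ∀ x ∈ Ici (max Y 1), HasDerivWithinAt
      (fun y : ℝ => ∑ k ∈ Finset.range (N + 1), (P k).eval (Real.log y) / y ^ k)
      (∑ k ∈ Finset.range (N + 1), ((Polynomial.derivative (P k)).eval (Real.log x) - k * (P k).eval (Real.log x)) / x ^ (k + 1))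
      (Ici (max Y 1)) x := by
    intro x hx
    have hx0 : 0 < x := lt_of_lt_of_le one_pos ((le_max_right _ _).trans hx)
    exact (HasDerivAt.fun_sum fun k _ => letterTerm_hasDerivAt (P k) k hx0).hasDerivWithinAt
  have hbound : ∀ x ∈ Ici (max Y 1),
      ‖∑ k ∈ Finset.range (N + 1), ((Polynomial.derivative (P k)).eval (Real.log x) - k * (P k).eval (Real.log x)) / x ^ (k + 1)‖
        ≤ 1 / 2 := by
    intro x hx
    obtain ⟨h1, h2⟩ := hY x ((le_max_left _ _).trans hx)
    rw [Real.norm_eq_abs]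
    refine (hb x h2).trans ?_
    rw [mul_div_assoc]
    exact h1.le
  have h := (convex_Ici (max Y 1)).norm_image_sub_le_of_norm_hasDerivWithin_le hderiv hbound hy₂ hy₁
  rw [Real.norm_eq_abs, Real.norm_eq_abs] at h
  exact h

/-! ## §2 Two approximate inverses are close -/

/-- The a priori window: `|ψ s − s| ≤ c(1 + log s)^D` eventually gives `s∕2 ≤ ψ s ≤ 2s` eventually. [folklore] -/
theorem window_of_apriori {ψ : ℝ → ℝ} {c : ℝ} {D : ℕ} (h : ∀ᶠ s : ℝ in atTop, |ψ s - s| ≤ c * (1 + Real.log s) ^ D) :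
    ∀ᶠ s : ℝ in atTop, s / 2 ≤ ψ s ∧ ψ s ≤ 2 * s := by
  have hlim : Tendsto (fun y : ℝ => c * ((1 + Real.log y) ^ D / y)) atTop (𝓝 (c * 0)) :=
    (tendsto_one_add_log_pow_div D).const_mul c
  rw [mul_zero] at hlim
  filter_upwards [h, hlim.eventually (gt_mem_nhds (by norm_num : (0 : ℝ) < 1 / 2)), eventually_gt_atTop (0 : ℝ)]
    with s hs hl hs0
  rw [← mul_div_assoc, div_lt_iff₀ hs0] at hl
  have h1 := (abs_le.1 (hs.trans hl.le))
  constructor <;> linarith [h1.1, h1.2]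

/-- The error of φ at an (approximate) inverse point: if `φ − id` is PL at order N (letters P, constant A, exponent d), ψ → ∞ and
`s∕2 ≤ ψ s ≤ 2s` eventually, then `|φ(ψ s) − ψ s − Σ_{k ≤ N} P_k(log ψ s)∕(ψ s)^k| ≤ |A|·2^d·2^{N+1}·(1 + log s)^d∕s^{N+1}` eventually
(the computation of P2 #36i `inverse_step`). [folklore] -/
theorem error_at_inverse {N : ℕ} {φ ψ : ℝ → ℝ} {P : ℕ → Polynomial ℝ} {A : ℝ} {d : ℕ}
    (hφ : ∀ᶠ y : ℝ in atTop, |(φ y - y) - ∑ k ∈ Finset.range (N + 1), (P k).eval (Real.log y) / y ^ k|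
      ≤ A * (1 + Real.log y) ^ d / y ^ (N + 1))
    (hψ : Tendsto ψ atTop atTop) (hwin : ∀ᶠ s : ℝ in atTop, s / 2 ≤ ψ s ∧ ψ s ≤ 2 * s) :
    ∀ᶠ s : ℝ in atTop, |(φ (ψ s) - ψ s) - ∑ k ∈ Finset.range (N + 1), (P k).eval (Real.log (ψ s)) / ψ s ^ k|
      ≤ |A| * 2 ^ d * 2 ^ (N + 1) * (1 + Real.log s) ^ d / s ^ (N + 1) := by
  have hT := hψ.eventually ((polyLog_abs_const hφ).and (eventually_ge_atTop (1 : ℝ)))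
  filter_upwards [hT, hwin, eventually_ge_atTop (1 : ℝ)] with s hs hw hs1
  obtain ⟨hEs, hψ1⟩ := hs
  obtain ⟨hlo, hhi⟩ := hw
  have hs0 : 0 < s := by linarith
  have hL : 0 ≤ Real.log s := Real.log_nonneg hs1
  have hLψ : 0 ≤ Real.log (ψ s) := Real.log_nonneg hψ1
  have hlψ : Real.log (ψ s) ≤ 1 + Real.log s := by
    have h := Real.log_le_log (by linarith) hhi
    rw [Real.log_mul (by norm_num) hs0.ne'] at h
    have h2 : Real.log 2 ≤ 2 - 1 := Real.log_le_sub_one_of_pos (by norm_num)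
    linarith
  have hcmp : (1 + Real.log (ψ s)) ^ d ≤ 2 ^ d * (1 + Real.log s) ^ d := by
    rw [← mul_pow]; exact pow_le_pow_left₀ (by linarith) (by linarith) d
  have hden : (s / 2) ^ (N + 1) ≤ ψ s ^ (N + 1) := pow_le_pow_left₀ (by positivity) hlo _
  have hsp : 0 < (s / 2) ^ (N + 1) := by positivity
  calc |(φ (ψ s) - ψ s) - ∑ k ∈ Finset.range (N + 1), (P k).eval (Real.log (ψ s)) / ψ s ^ k|
      ≤ |A| * (1 + Real.log (ψ s)) ^ d / ψ s ^ (N + 1) := hEs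
    _ ≤ |A| * (2 ^ d * (1 + Real.log s) ^ d) / ψ s ^ (N + 1) :=
        div_le_div_of_nonneg_right (mul_le_mul_of_nonneg_left hcmp (abs_nonneg A)) (by positivity)
    _ ≤ |A| * (2 ^ d * (1 + Real.log s) ^ d) / (s / 2) ^ (N + 1) :=
        div_le_div_of_nonneg_left (by positivity) hsp hden
    _ = |A| * 2 ^ d * 2 ^ (N + 1) * (1 + Real.log s) ^ d / s ^ (N + 1) := by
        rw [div_pow]
        field_simp

/-- **TWO APPROXIMATE INVERSES ARE CLOSE**: if φ₁ − id and φ₂ − id carry the SAME letters P at order N (any constants, exponents),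
ψ₁, ψ₂ → ∞ and `|φ_i(ψ_i s) − s| ≤ B_i·(1 + log s)^{e_i}∕s^{N+1}` eventually (i = 1, 2), then
`|ψ₁ s − ψ₂ s| ≤ K·(1 + log s)^D∕s^{N+1}` eventually — from `ψ₁ − ψ₂ + (S(ψ₁) − S(ψ₂)) = defects − errors` and the ½-Lipschitz bound
`letterSum_lipschitz_half` on S. [folklore] -/
theorem approxInverse_close {N : ℕ} {φ₁ φ₂ ψ₁ ψ₂ : ℝ → ℝ} {P : ℕ → Polynomial ℝ} {A₁ A₂ B₁ B₂ : ℝ} {d₁ d₂ e₁ e₂ : ℕ}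
    (hφ₁ : ∀ᶠ y : ℝ in atTop, |(φ₁ y - y) - ∑ k ∈ Finset.range (N + 1), (P k).eval (Real.log y) / y ^ k|
      ≤ A₁ * (1 + Real.log y) ^ d₁ / y ^ (N + 1))
    (hψ₁ : Tendsto ψ₁ atTop atTop)
    (hinv₁ : ∀ᶠ s : ℝ in atTop, |φ₁ (ψ₁ s) - s| ≤ B₁ * (1 + Real.log s) ^ e₁ / s ^ (N + 1))
    (hφ₂ : ∀ᶠ y : ℝ in atTop, |(φ₂ y - y) - ∑ k ∈ Finset.range (N + 1), (P k).eval (Real.log y) / y ^ k|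
      ≤ A₂ * (1 + Real.log y) ^ d₂ / y ^ (N + 1))
    (hψ₂ : Tendsto ψ₂ atTop atTop)
    (hinv₂ : ∀ᶠ s : ℝ in atTop, |φ₂ (ψ₂ s) - s| ≤ B₂ * (1 + Real.log s) ^ e₂ / s ^ (N + 1)) :
    ∃ K : ℝ, ∃ D : ℕ, ∀ᶠ s : ℝ in atTop, |ψ₁ s - ψ₂ s| ≤ K * (1 + Real.log s) ^ D / s ^ (N + 1) := by
  obtain ⟨Y, hY1, hLip⟩ := letterSum_lipschitz_half P N
  obtain ⟨c₁, D₁, -, hb₁⟩ := inverse_apriori hφ₁ hψ₁ hinv₁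
  obtain ⟨c₂, D₂, -, hb₂⟩ := inverse_apriori hφ₂ hψ₂ hinv₂
  have hw₁ := window_of_apriori hb₁
  have hw₂ := window_of_apriori hb₂
  have hE₁ := error_at_inverse hφ₁ hψ₁ hw₁
  have hE₂ := error_at_inverse hφ₂ hψ₂ hw₂
  set D : ℕ := e₁ + e₂ + d₁ + d₂ with hD
  refine ⟨2 * (|B₁| + |B₂| + |A₁| * 2 ^ d₁ * 2 ^ (N + 1) + |A₂| * 2 ^ d₂ * 2 ^ (N + 1)), D, ?_⟩
  filter_upwards [hinv₁, hinv₂, hE₁, hE₂, hw₁, hw₂, eventually_ge_atTop (1 : ℝ), eventually_ge_atTop (2 * Y)]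
    with s hi₁ hi₂ he₁ he₂ hw₁' hw₂' hs1 hsY
  have hs0 : 0 < s := by linarith
  have hL : 0 ≤ Real.log s := Real.log_nonneg hs1
  have h1L : 1 ≤ 1 + Real.log s := by linarith
  have hsN : 0 < s ^ (N + 1) := pow_pos hs0 _
  -- the letter sums at the two points
  set S₁ := ∑ k ∈ Finset.range (N + 1), (P k).eval (Real.log (ψ₁ s)) / ψ₁ s ^ k with hS₁
  set S₂ := ∑ k ∈ Finset.range (N + 1), (P k).eval (Real.log (ψ₂ s)) / ψ₂ s ^ k with hS₂
  have hS : |S₁ - S₂| ≤ 1 / 2 * |ψ₁ s - ψ₂ s| := hLip _ _ (by linarith [hw₁'.1]) (by linarith [hw₂'.1])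
  -- the identity
  have e : ψ₁ s - ψ₂ s = ((φ₁ (ψ₁ s) - s) - (φ₂ (ψ₂ s) - s)) - ((φ₁ (ψ₁ s) - ψ₁ s) - S₁) + ((φ₂ (ψ₂ s) - ψ₂ s) - S₂)
      - (S₁ - S₂) := by ring
  -- powers of (1 + log s) up to D
  have hp : ∀ e : ℕ, e ≤ D → (1 + Real.log s) ^ e ≤ (1 + Real.log s) ^ D := fun e he => pow_le_pow_right₀ h1L he
  have hB₁ : B₁ * (1 + Real.log s) ^ e₁ / s ^ (N + 1) ≤ |B₁| * (1 + Real.log s) ^ D / s ^ (N + 1) :=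
    div_le_div_of_nonneg_right (mul_le_mul (le_abs_self _) (hp e₁ (by omega)) (by positivity) (abs_nonneg _)) hsN.le
  have hB₂ : B₂ * (1 + Real.log s) ^ e₂ / s ^ (N + 1) ≤ |B₂| * (1 + Real.log s) ^ D / s ^ (N + 1) :=
    div_le_div_of_nonneg_right (mul_le_mul (le_abs_self _) (hp e₂ (by omega)) (by positivity) (abs_nonneg _)) hsN.le
  have hA₁ : |A₁| * 2 ^ d₁ * 2 ^ (N + 1) * (1 + Real.log s) ^ d₁ / s ^ (N + 1)
      ≤ |A₁| * 2 ^ d₁ * 2 ^ (N + 1) * (1 + Real.log s) ^ D / s ^ (N + 1) :=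
    div_le_div_of_nonneg_right (mul_le_mul_of_nonneg_left (hp d₁ (by omega)) (by positivity)) hsN.le
  have hA₂ : |A₂| * 2 ^ d₂ * 2 ^ (N + 1) * (1 + Real.log s) ^ d₂ / s ^ (N + 1)
      ≤ |A₂| * 2 ^ d₂ * 2 ^ (N + 1) * (1 + Real.log s) ^ D / s ^ (N + 1) :=
    div_le_div_of_nonneg_right (mul_le_mul_of_nonneg_left (hp d₂ (by omega)) (by positivity)) hsN.le
  have hR : |((φ₁ (ψ₁ s) - s) - (φ₂ (ψ₂ s) - s)) - ((φ₁ (ψ₁ s) - ψ₁ s) - S₁) + ((φ₂ (ψ₂ s) - ψ₂ s) - S₂)|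
      ≤ (|B₁| + |B₂| + |A₁| * 2 ^ d₁ * 2 ^ (N + 1) + |A₂| * 2 ^ d₂ * 2 ^ (N + 1)) * (1 + Real.log s) ^ D / s ^ (N + 1) := by
    calc _ ≤ |(φ₁ (ψ₁ s) - s) - (φ₂ (ψ₂ s) - s)| + |(φ₁ (ψ₁ s) - ψ₁ s) - S₁| + |(φ₂ (ψ₂ s) - ψ₂ s) - S₂| :=
          (abs_add_le _ _).trans (add_le_add (abs_sub _ _) le_rfl)
      _ ≤ (|φ₁ (ψ₁ s) - s| + |φ₂ (ψ₂ s) - s|) + |(φ₁ (ψ₁ s) - ψ₁ s) - S₁| + |(φ₂ (ψ₂ s) - ψ₂ s) - S₂| :=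
          add_le_add (add_le_add (abs_sub _ _) le_rfl) le_rfl
      _ ≤ (|B₁| * (1 + Real.log s) ^ D / s ^ (N + 1) + |B₂| * (1 + Real.log s) ^ D / s ^ (N + 1))
            + |A₁| * 2 ^ d₁ * 2 ^ (N + 1) * (1 + Real.log s) ^ D / s ^ (N + 1)
            + |A₂| * 2 ^ d₂ * 2 ^ (N + 1) * (1 + Real.log s) ^ D / s ^ (N + 1) :=
          add_le_add (add_le_add (add_le_add (hi₁.trans hB₁) (hi₂.trans hB₂)) (he₁.trans hA₁)) (he₂.trans hA₂)
      _ = _ := by ring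
  -- absorb the Lipschitz half
  have hmain : |ψ₁ s - ψ₂ s| ≤ (|B₁| + |B₂| + |A₁| * 2 ^ d₁ * 2 ^ (N + 1) + |A₂| * 2 ^ d₂ * 2 ^ (N + 1))
      * (1 + Real.log s) ^ D / s ^ (N + 1) + 1 / 2 * |ψ₁ s - ψ₂ s| := by
    rw [e]
    refine (abs_sub _ _).trans ?_
    have : |ψ₁ s - ψ₂ s| = |((φ₁ (ψ₁ s) - s) - (φ₂ (ψ₂ s) - s)) - ((φ₁ (ψ₁ s) - ψ₁ s) - S₁) + ((φ₂ (ψ₂ s) - ψ₂ s) - S₂)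
        - (S₁ - S₂)| := by rw [← e]
    rw [← this]
    exact add_le_add hR hS
  have hfin : |ψ₁ s - ψ₂ s| ≤ 2 * ((|B₁| + |B₂| + |A₁| * 2 ^ d₁ * 2 ^ (N + 1) + |A₂| * 2 ^ d₂ * 2 ^ (N + 1))
      * (1 + Real.log s) ^ D / s ^ (N + 1)) := by linarith
  calc |ψ₁ s - ψ₂ s| ≤ _ := hfin
    _ = 2 * (|B₁| + |B₂| + |A₁| * 2 ^ d₁ * 2 ^ (N + 1) + |A₂| * 2 ^ d₂ * 2 ^ (N + 1)) * (1 + Real.log s) ^ D / s ^ (N + 1) := by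
        ring

/-! ## §3 The inverse letters are canonical -/

/-- **THE INVERSE LETTERS ARE CANONICAL (HEADLINE).**  Under the hypotheses of `approxInverse_close` (two pairs realizing the SAME
letters P at order N), ANY letters Q₁ of `ψ₁ − id` and Q₂ of `ψ₂ − id` at order N agree up to N: `Q₁ k = Q₂ k` for k ≤ N — the
inverse letters depend on P_0, …, P_N ALONE (closeness + P2 #36g `polyLog_letters_unique`). [folklore] -/
theorem polyLog_inverse_canonical (N : ℕ) {φ₁ φ₂ ψ₁ ψ₂ : ℝ → ℝ} {P : ℕ → Polynomial ℝ} {A₁ A₂ B₁ B₂ : ℝ} {d₁ d₂ e₁ e₂ : ℕ}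
    (hφ₁ : ∀ᶠ y : ℝ in atTop, |(φ₁ y - y) - ∑ k ∈ Finset.range (N + 1), (P k).eval (Real.log y) / y ^ k|
      ≤ A₁ * (1 + Real.log y) ^ d₁ / y ^ (N + 1))
    (hψ₁ : Tendsto ψ₁ atTop atTop)
    (hinv₁ : ∀ᶠ s : ℝ in atTop, |φ₁ (ψ₁ s) - s| ≤ B₁ * (1 + Real.log s) ^ e₁ / s ^ (N + 1))
    (hφ₂ : ∀ᶠ y : ℝ in atTop, |(φ₂ y - y) - ∑ k ∈ Finset.range (N + 1), (P k).eval (Real.log y) / y ^ k|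
      ≤ A₂ * (1 + Real.log y) ^ d₂ / y ^ (N + 1))
    (hψ₂ : Tendsto ψ₂ atTop atTop)
    (hinv₂ : ∀ᶠ s : ℝ in atTop, |φ₂ (ψ₂ s) - s| ≤ B₂ * (1 + Real.log s) ^ e₂ / s ^ (N + 1))
    {Q₁ Q₂ : ℕ → Polynomial ℝ} {AQ₁ AQ₂ : ℝ} {dQ₁ dQ₂ : ℕ}
    (hQ₁ : ∀ᶠ s : ℝ in atTop, |(ψ₁ s - s) - ∑ k ∈ Finset.range (N + 1), (Q₁ k).eval (Real.log s) / s ^ k|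
      ≤ AQ₁ * (1 + Real.log s) ^ dQ₁ / s ^ (N + 1))
    (hQ₂ : ∀ᶠ s : ℝ in atTop, |(ψ₂ s - s) - ∑ k ∈ Finset.range (N + 1), (Q₂ k).eval (Real.log s) / s ^ k|
      ≤ AQ₂ * (1 + Real.log s) ^ dQ₂ / s ^ (N + 1)) :
    ∀ k, k ≤ N → Q₁ k = Q₂ k := by
  obtain ⟨K, D, hclose⟩ := approxInverse_close hφ₁ hψ₁ hinv₁ hφ₂ hψ₂ hinv₂
  have hdiff : ∀ᶠ s : ℝ in atTop, |ψ₂ s - ψ₁ s| ≤ K * (1 + Real.log s) ^ D / s ^ (N + 1) := by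
    filter_upwards [hclose] with s hs; rwa [abs_sub_comm] at hs
  obtain ⟨A', d', h⟩ := polyLog_add hQ₁ (polyLog_of_error hdiff)
  have h' := polyLog_congr (g := fun s => ψ₂ s - s) h (Eventually.of_forall fun s => by ring)
  have hagree := polyLog_letters_unique N h' hQ₂
  intro k hk
  have := hagree k hk
  simpa using this

/-- **ONE LETTER SEQUENCE SERVES EVERY REALIZATION**: under the same hypotheses, there is `Q` with Q 0 = −P 0 carrying the order-N
expansion of BOTH `ψ₁ − id` and `ψ₂ − id` (P2 #36i `polyLog_inverse` for each pair + `polyLog_inverse_canonical`). [folklore] -/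
theorem polyLog_inverse_letters_eq (N : ℕ) {φ₁ φ₂ ψ₁ ψ₂ : ℝ → ℝ} {P : ℕ → Polynomial ℝ} {A₁ A₂ B₁ B₂ : ℝ} {d₁ d₂ e₁ e₂ : ℕ}
    (hφ₁ : ∀ᶠ y : ℝ in atTop, |(φ₁ y - y) - ∑ k ∈ Finset.range (N + 1), (P k).eval (Real.log y) / y ^ k|
      ≤ A₁ * (1 + Real.log y) ^ d₁ / y ^ (N + 1))
    (hψ₁ : Tendsto ψ₁ atTop atTop)
    (hinv₁ : ∀ᶠ s : ℝ in atTop, |φ₁ (ψ₁ s) - s| ≤ B₁ * (1 + Real.log s) ^ e₁ / s ^ (N + 1))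
    (hφ₂ : ∀ᶠ y : ℝ in atTop, |(φ₂ y - y) - ∑ k ∈ Finset.range (N + 1), (P k).eval (Real.log y) / y ^ k|
      ≤ A₂ * (1 + Real.log y) ^ d₂ / y ^ (N + 1))
    (hψ₂ : Tendsto ψ₂ atTop atTop)
    (hinv₂ : ∀ᶠ s : ℝ in atTop, |φ₂ (ψ₂ s) - s| ≤ B₂ * (1 + Real.log s) ^ e₂ / s ^ (N + 1)) :
    ∃ Q : ℕ → Polynomial ℝ, Q 0 = -P 0 ∧
      (∃ (A' : ℝ) (d' : ℕ), 0 ≤ A' ∧ ∀ᶠ s : ℝ in atTop,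
        |(ψ₁ s - s) - ∑ k ∈ Finset.range (N + 1), (Q k).eval (Real.log s) / s ^ k| ≤ A' * (1 + Real.log s) ^ d' / s ^ (N + 1)) ∧
      (∃ (A' : ℝ) (d' : ℕ), 0 ≤ A' ∧ ∀ᶠ s : ℝ in atTop,
        |(ψ₂ s - s) - ∑ k ∈ Finset.range (N + 1), (Q k).eval (Real.log s) / s ^ k| ≤ A' * (1 + Real.log s) ^ d' / s ^ (N + 1)) := by
  obtain ⟨Q₁, A₁', d₁', hQ0, hA₁', hQ₁⟩ := polyLog_inverse N hφ₁ hψ₁ hinv₁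
  obtain ⟨Q₂, A₂', d₂', -, hA₂', hQ₂⟩ := polyLog_inverse N hφ₂ hψ₂ hinv₂
  have hagree := polyLog_inverse_canonical N hφ₁ hψ₁ hinv₁ hφ₂ hψ₂ hinv₂ hQ₁ hQ₂
  refine ⟨Q₁, hQ0, ⟨A₁', d₁', hA₁', hQ₁⟩, ⟨A₂', d₂', hA₂', ?_⟩⟩
  filter_upwards [hQ₂] with s hs
  have e : ∑ k ∈ Finset.range (N + 1), (Q₁ k).eval (Real.log s) / s ^ k
      = ∑ k ∈ Finset.range (N + 1), (Q₂ k).eval (Real.log s) / s ^ k :=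
    Finset.sum_congr rfl fun k hk => by rw [hagree k (Nat.lt_succ_iff.1 (Finset.mem_range.1 hk))]
  rw [e]
  exact hs

/-! ## §4 Application shape: pairs `φ = Λ(1∕·)`, `ψ = 1∕σ` (the running-coupling letters are canonical in the Λ-letters) -/

/-- **THE INVERSE-COUPLING LETTERS ARE CANONICAL IN THE Λ-LETTERS** (the shape P2 #36j uses): if `Λ₁(1∕s) − s` and `Λ₂(1∕s) − s` carry the
SAME letters Q at order N, `σ_i → 0⁺` and `Λ_i (σ_i y) = y` eventually (i = 1, 2), then ANY order-N letters P₁ of `1∕σ₁ − id` and P₂ of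
`1∕σ₂ − id` agree up to N — two Λ-coordinates with the same expansion (e.g. the same κ, C_Λ, c_k in a Λ-law) have running couplings with
the same letters P_0, …, P_N (`polyLog_inverse_canonical` for φ_i = Λ_i(1∕·), ψ_i = 1∕σ_i). [folklore] -/
theorem inverseCoupling_letters_canonical (N : ℕ) {Λ₁ Λ₂ σ₁ σ₂ : ℝ → ℝ} {Q : ℕ → Polynomial ℝ} {A₁ A₂ : ℝ} {d₁ d₂ : ℕ}
    (hQ₁ : ∀ᶠ s : ℝ in atTop, |(Λ₁ (1 / s) - s) - ∑ k ∈ Finset.range (N + 1), (Q k).eval (Real.log s) / s ^ k|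
      ≤ A₁ * (1 + Real.log s) ^ d₁ / s ^ (N + 1))
    (hσ0₁ : Tendsto σ₁ atTop (𝓝[>] 0)) (hσ₁ : ∀ᶠ y in atTop, Λ₁ (σ₁ y) = y)
    (hQ₂ : ∀ᶠ s : ℝ in atTop, |(Λ₂ (1 / s) - s) - ∑ k ∈ Finset.range (N + 1), (Q k).eval (Real.log s) / s ^ k|
      ≤ A₂ * (1 + Real.log s) ^ d₂ / s ^ (N + 1))
    (hσ0₂ : Tendsto σ₂ atTop (𝓝[>] 0)) (hσ₂ : ∀ᶠ y in atTop, Λ₂ (σ₂ y) = y)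
    {P₁ P₂ : ℕ → Polynomial ℝ} {B₁ B₂ : ℝ} {e₁ e₂ : ℕ}
    (hP₁ : ∀ᶠ y : ℝ in atTop, |(1 / σ₁ y - y) - ∑ k ∈ Finset.range (N + 1), (P₁ k).eval (Real.log y) / y ^ k|
      ≤ B₁ * (1 + Real.log y) ^ e₁ / y ^ (N + 1))
    (hP₂ : ∀ᶠ y : ℝ in atTop, |(1 / σ₂ y - y) - ∑ k ∈ Finset.range (N + 1), (P₂ k).eval (Real.log y) / y ^ k|
      ≤ B₂ * (1 + Real.log y) ^ e₂ / y ^ (N + 1)) :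
    ∀ k, k ≤ N → P₁ k = P₂ k := by
  have hψ : ∀ {σ : ℝ → ℝ}, Tendsto σ atTop (𝓝[>] 0) → Tendsto (fun y : ℝ => 1 / σ y) atTop atTop := by
    intro σ hσ0
    have h := tendsto_inv_nhdsGT_zero.comp hσ0
    simpa only [Function.comp_def, one_div] using h
  have hinv : ∀ {Λ σ : ℝ → ℝ}, (∀ᶠ y in atTop, Λ (σ y) = y) →
      ∀ᶠ y : ℝ in atTop, |(fun s => Λ (1 / s)) ((fun y => 1 / σ y) y) - y| ≤ 0 * (1 + Real.log y) ^ 0 / y ^ (N + 1) := by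
    intro Λ σ hσ
    refine defect_of_rightInverse N ?_
    filter_upwards [hσ] with y hy
    show Λ (1 / (1 / σ y)) = y
    rw [one_div_one_div, hy]
  exact polyLog_inverse_canonical N (φ₁ := fun s => Λ₁ (1 / s)) (ψ₁ := fun y => 1 / σ₁ y) (φ₂ := fun s => Λ₂ (1 / s))
    (ψ₂ := fun y => 1 / σ₂ y) hQ₁ (hψ hσ0₁) (hinv hσ₁) hQ₂ (hψ hσ0₂) (hinv hσ₂) hP₁ hP₂

end

end Summit.QuantumFields.BalabanUV.Beta.EriceFlowEnclosurePolyLogInversionCanonical
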